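import Summits.BirchSwinnertonDyer.BirchSwinnertonDyer.Theorems.RamifiedHeegnerPairLeafRankOneUpperAtThreeTwistUnitTwoSplit
import Summits.BirchSwinnertonDyer.BirchSwinnertonDyer.Theorems.RamifiedHeegnerPairLeafRankOneUpperAtThreeMonoCarrierAny
import HarnessLib

/-!
# Route `RamifiedHeegnerPair`, crux U₁ `LeafRankOneUpperAtThree` (stmt-BirchSwinnertonDyer-26022), line `splitkolyvagin` —
# the PARTNER-LOWER and TWIST-UNIT roads over the ANY-CARRIER reading: U₁ ⟸ PUB⁺ ∧ three named facts ∧ Σ★‴ ∧ PL₀|₂ (tight), and the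
# per-curve CERTIFICATE SHAPE on a mono-carrier row of ANY reduction type: U₁ at `W` ⟸ print ∧ F1–F3 ∧ ONE twist-unit certificate

HONEST FRAMING. Theorems only; helper file (`--supports stmt-BirchSwinnertonDyer-26022 --as helper`); nothing is booked, no item is
closed, BSD is not proved for any curve; CONDITIONAL on every displayed input. Lead prover bsd-line-rhp-p2 g9, 2026-08-28. = p640701
(`…PartnerLowerTwoSplit`) and p641092 (`…TwistUnitTwoSplit`) re-run with the 2-split reading S2|₂ replaced by the ANY-CARRIER reading R|₂
(`JetchevReadingAnyCarrier.anyCarrierTwoSplitReading_of_namedFacts`, p643642) and the research residue Σ★″ (27493) replaced by the weaker Σ★‴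
(off the mono-carrier rows of any reduction type; `sigmaStarOptOffMonoRows_of_sigmaStarOptOffRows`, p645042).

* §1 `leafRankOneUpper_three_monoCarrierAny_of_anyCarrierReading_of_partnerLowerTwoSplit` — U₁ at `W` on ONE mono-carrier row (carrier
  `q ∣ N_E` of any type) with a `3 ∤ c` datum, from print + R|₂ + PL₀|₂(W) (p640701 §2 minus `q ∥ N` / multiplicativity / `q ≠ 3`).
* §2 `leafRankOneUpper_three_of_latticeOptimal_of_namedFacts_of_sigmaStarMono_of_partnerLowerTwoSplit`, §3
  **`leafRankOneUpperAtThree_of_pubManin_of_namedFacts_of_sigmaStarMono_of_partnerLowerTwoSplit`** : `LeafRankOnePrintedInputsAtThree → F1 → F2 →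
  F3 → Σ★‴ → PL₀|₂ → LeafRankOneUpperAtThree` — NO L₀; PL₀|₂ ⟸ L₀ and PL₀|₂ ⟸ the leaf (tight) are p640701 §5, unchanged.
* §4 **`leafRankOneUpper_three_monoCarrierAny_of_namedFacts_of_twistUnitTwoSplit`** — the per-curve CERTIFICATE SHAPE: U₁ AT ONE CURVE on a
  mono-carrier row of ANY reduction type ⟸ printed facts ∧ {F1, F2, F3} ∧ TU₁|₂(W) — no S2, no L₀, no Σ. Serves the 9 single-ADDITIVE-carrier
  rank-one Gss2 classes exactly as p641092 §2 serves the 99 mono-multiplicative ones (trib-w-rhp census: twist-unit fields with `d ≡ 1 (mod 8)`).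
* §5 `leafRankOneUpperAtThree_of_pubManin_of_namedFacts_of_sigmaStarMono_of_twistUnitTwoSplit` — class-wide: U₁ ⟸ PUB⁺ ∧ F1–F3 ∧ Σ★‴ ∧ TU₁|₂.

NET (mod print ∪ {F1, F2, F3}): **U₁ ⟸ Σ★‴ ∧ (L₀ | PL₀|₂ | TU₁|₂)** — all three partner roads of record now run over the any-carrier reading.
References: [cite: Jetchev2008, Thm. 1.4 (ii), Cor. 1.5, Conj. 1.3 (p. 812)] [cite: GrossLMS1991, Prop. 3.7 (2) (p. 240), §6 p. 245]
[cite: MilneADT2006, Ch. I, Thm. 4.10(b); Thm. I.7.3 and Remark I.7.4] [cite: GrossZagier1986, III (3.1); Thm. I.(6.3) and (7.3)]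
[cite: MatarNekovar2019, Thm. 0.7 (p. 456)] [cite: KrizLi2019, Thm. 1.20] [cite: Mazur1978, Cor. 4.1] [cite: Miller2011LMS, §1 and Def. 1.1].
-/

-- D-0017: single-problem summit, so `Summit.BirchSwinnertonDyer.BirchSwinnertonDyer.…` repeats a namespace BY DESIGN.
set_option linter.dupNamespace false
set_option autoImplicit false

noncomputable section

open scoped Classical NumberField

open WeierstrassCurve IsDedekindDomain IsDedekindDomain.HeightOneSpectrum NumberField
  Rat.HeightOneSpectrum Literature Literature.NumberTheory.EllipticCurves
  Literature.NumberTheory.EllipticCurves.ModularForms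
  Literature.NumberTheory.EllipticCurves.Rank1Residual
  Literature.NumberTheory.EllipticCurves.Rank1Residual.Typed
  Literature.NumberTheory.EllipticCurves.KrizLi2019
  Literature.NumberTheory.QuadraticFields
  Summit.BirchSwinnertonDyer.Rank1Residual
  Summit.BirchSwinnertonDyer.Rank1Residual.Additive
  Summit.BirchSwinnertonDyer.Rank1Residual.X11b.Three
  Summit.BirchSwinnertonDyer.BirchSwinnertonDyer.Theses.RamifiedHeegnerPair
  Summit.BirchSwinnertonDyer.BirchSwinnertonDyer.Theorems
  Summit.BirchSwinnertonDyer.BirchSwinnertonDyer.Theorems.SchneiderFree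
  Summit.BirchSwinnertonDyer.BirchSwinnertonDyer.Theorems.JetchevReadingAnyCarrier

namespace Summit.BirchSwinnertonDyer.BirchSwinnertonDyer.Theorems.RamifiedPairUpperBound

/-! ## §1 The mono-carrier rows of ANY reduction type: U₁ ⟸ print + R|₂ + PL₀|₂(W) -/

/-- **U₁ AT `W` ON A MONO-CARRIER ROW (carrier of ANY reduction type) WITH A MANIN-CLEAN DATUM, from the any-carrier reading R|₂ and PL₀|₂(W)**
— p640701 §2 with S2|₂ ↦ R|₂: the carrier is any prime `q ∣ N_E` with `ord₃ ∏ c_ℓ(W) ≤ ord₃ c_q(W)`; no `q ∥ N`, no «carriers multiplicative»,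
no `q ≠ 3` step. CONDITIONAL; nothing asserted. [cite: Jetchev2008, Thm. 1.4 and Cor. 1.5 (p. 812)] [cite: MatarNekovar2019, Thm. 0.7 (p. 456)]
[cite: GrossZagier1986, Thm. I.(6.3) and (7.3)] [cite: Miller2011LMS, Def. 1.1] -/
theorem leafRankOneUpper_three_monoCarrierAny_of_anyCarrierReading_of_partnerLowerTwoSplit
    (hGZ : ∀ (N : ℕ) [NeZero N] (W : WeierstrassCurve ℚ) (K : Type) [Field K] [NumberField K],
      gross_zagier N W K)
    (hKo : ∀ (N : ℕ) [NeZero N] (W : WeierstrassCurve ℚ) (K : Type) [Field K] [NumberField K],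
      kolyvagin N W K)
    (hGZK : rank_eq_analyticRank_of_analyticRank_le_one) (hmod : hasEntireLFunction_rat)
    (hGZ73 : GrossZagier1986_thm_I_7_3)
    (hMN : MatarNekovar2019.thm07_padicValNat_card_sha_primary_add_le_of_globalDivisibility_of_irreducible)
    (hR₂ : ∀ (W : WeierstrassCurve ℚ) [W.IsElliptic] [W.IsGloballyMinimal] [NeZero (W.conductorNorm ℤ)],
      ¬ W.HasCM →
      ∀ (K : Type) [Field K] [NumberField K], IsImaginaryQuadratic K →
      NumberField.discr K ≠ -3 → NumberField.discr K ≠ -4 →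
      SatisfiesHeegnerHypothesis (W.conductorNorm ℤ) K → SatisfiesHeegnerHypothesis 2 K →
      ∀ (p : ℕ) [Fact p.Prime], p ≠ 2 → Addv W p → W.HasIrreducibleModPGaloisRep p →
      ∀ (Dt : ModularParametrizationData W (W.conductorNorm ℤ)) (β : ℤ) (ι : K →+* ℂ)
        (d₁ : KolyvaginHeegnerData Dt β ι 1), ¬ IsOfFinAddOrder d₁.derivedPoint →
      ∀ (q : ℕ) [Fact q.Prime], q ∣ W.conductorNorm ℤ →
      ∀ (s : ℕ), s ≤ padicValNat p ((W.baseChange ℚ_[q]).localTamagawaNumber ℤ_[q]) →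
        ∀ (n : ℕ) (d : KolyvaginHeegnerData Dt β ι n), Squarefree n →
          (∀ ℓ ∈ n.primeFactors, Zhang2014.IsKolyvaginPrime (W.conductorNorm ℤ) W K p ℓ ∧
            s ≤ Zhang2014.kolyvaginIndex W p ℓ) →
          ∃ Q : (W.baseChange (ringClassField K ι n)).toAffine.Point,
            ((p ^ s : ℕ) : ℤ) • Q = d.derivedPoint)
    (W : WeierstrassCurve ℚ) [W.IsElliptic] [W.IsGloballyMinimal] [NeZero (W.conductorNorm ℤ)]
    (hCM : ¬ W.HasCM) (hadd : Addv W 3) (hsub : SubGss W 3) (hr : W.analyticRank = 1)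
    (q : ℕ) [Fact q.Prime] (hqN : q ∣ W.conductorNorm ℤ)
    (hmono : padicValNat 3 W.tamagawaProduct ≤ padicValNat 3 ((W.baseChange ℚ_[q]).localTamagawaNumber ℤ_[q]))
    (Dt : ModularParametrizationData W (W.conductorNorm ℤ)) (hc : ¬ (3 : ℤ) ∣ Dt.c)
    (hPL : ∃ (K : Type) (_ : Field K) (_ : NumberField K) (Wd : WeierstrassCurve ℚ) (_ : Wd.IsElliptic) (_ : Wd.IsGloballyMinimal),
      IsImaginaryQuadratic K ∧ Odd (NumberField.discr K) ∧ SatisfiesHeegnerHypothesis (W.conductorNorm ℤ) K ∧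
      SatisfiesHeegnerHypothesis 2 K ∧ (W.quadraticTwist (NumberField.discr K : ℚ)).entireLFunction 1 ≠ 0 ∧
      (∃ C : VariableChange ℚ, C • W.quadraticTwist (NumberField.discr K : ℚ) = Wd) ∧ MissingLowerBoundAt Wd 3) :
    MissingUpperBoundAt W 3 := by
  have hirr : W.HasIrreducibleModPGaloisRep 3 := (classX4_three_of_addv_of_subGss W hadd hsub).2.2
  have h3N : 3 ∣ W.conductorNorm ℤ :=
    (W.dvd_conductorNorm_iff_not_hasGoodReductionAtPrime 3).mpr (not_good_of_addv W 3 hadd)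
  have hc0 : padicValNat 3 Dt.c.natAbs = 0 :=
    padicValNat.eq_zero_of_not_dvd fun h ↦ hc (Int.ofNat_dvd_left.mpr h)
  refine leafRankOneUpper_three_of_sigmaAtDatumTwoSplit_of_partnerLowerTwoSplit hGZ hKo hGZK hmod hGZ73 hMN W hCM hadd hsub hr
    Dt hPL ?_
  intro K _ _ H ι P hK hHN hH2 hLt hP hnt hodd s' hs' n d hn hℓ
  have hsq : s' ≤ padicValNat 3 ((W.baseChange ℚ_[q]).localTamagawaNumber ℤ_[q]) := by omega
  have h3 : NumberField.discr K ≠ -3 := by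
    intro h
    exact (X11b.Three.not_dvd_discr_and_not_dvd_torsionOrder_of_heegner hK hHN (by decide) h3N).1
      (h ▸ ⟨-1, by norm_num⟩)
  have h4 : NumberField.discr K ≠ -4 := by
    intro h
    rw [h] at hodd
    exact (Int.not_odd_iff_even.mpr ⟨-2, by norm_num⟩) hodd
  obtain ⟨d₁⟩ := exists_kolyvaginHeegnerData_one
    (phi_heegnerTau_mem_singularModuliField_holds (W.conductorNorm ℤ) W K) hK Dt H.β ι H.dvd_sq_sub
  have hPd : d₁.toGeomPoints d₁.derivedPoint = toGeomPoints (W.baseChange K) P :=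
    X11b.KolyvaginBottom.toGeomPoints_derivedPoint_one_eq
      (heegnerPointOfConductor_one_galoisConj_holds (W.conductorNorm ℤ) W K) hK hHN hP d₁ rfl
  have hy₁ : ¬ IsOfFinAddOrder d₁.derivedPoint := by
    intro hfin
    apply hnt
    have h1 : IsOfFinAddOrder (d₁.toGeomPoints d₁.derivedPoint) := d₁.toGeomPoints.isOfFinAddOrder hfin
    rw [hPd] at h1
    exact (toGeomPoints_injective (W.baseChange K)).isOfFinAddOrder_iff.mp h1
  exact hR₂ W hCM K hK h3 h4 hHN hH2 3 (by decide) hadd hirr Dt H.β ι d₁ hy₁ q hqN s' hsq n d hn hℓ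

/-! ## §2 At a lattice-optimal member: U₁ ⟸ print⁺ + three named facts + Σ★‴ + PL₀|₂(W) -/

/-- **U₁ AT A LEAF CURVE CARRYING A LATTICE-OPTIMAL DATUM ⟸ print⁺ + {F1, F2, F3} + Σ★‴ + PL₀|₂(W)** — p640701 §3 with the row predicate
widened to the mono-carrier rows of any reduction type (ON: §1 fed by `anyCarrierTwoSplitReading_of_namedFacts`; OFF: p640701 §1 with Σ★‴
at the datum, through `sigmaOptOffMonoRows_of_sigmaStarOptOffMonoRows`). CONDITIONAL; nothing asserted. [cite: Jetchev2008, Conj. 1.3, Thm. 1.4 (p. 812)]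
[cite: GrossLMS1991, Prop. 3.7 (2)] [cite: MilneADT2006, Ch. I, Thm. 4.10(b)] [cite: Mazur1978, Cor. 4.1] [cite: Miller2011LMS, Def. 1.1] -/
theorem leafRankOneUpper_three_of_latticeOptimal_of_namedFacts_of_sigmaStarMono_of_partnerLowerTwoSplit
    (hGZ : ∀ (N : ℕ) [NeZero N] (W : WeierstrassCurve ℚ) (K : Type) [Field K] [NumberField K],
      gross_zagier N W K)
    (hKo : ∀ (N : ℕ) [NeZero N] (W : WeierstrassCurve ℚ) (K : Type) [Field K] [NumberField K],
      kolyvagin N W K)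
    (hGZK : rank_eq_analyticRank_of_analyticRank_le_one) (hmod : hasEntireLFunction_rat)
    (hGZ73 : GrossZagier1986_thm_I_7_3)
    (hMN : MatarNekovar2019.thm07_padicValNat_card_sha_primary_add_le_of_globalDivisibility_of_irreducible)
    (hnf : exists_isNewformOf)
    (hM : mazur_not_dvd_maninConstant_of_odd) (hAU : abbesUllmo_not_dvd_maninConstant_of_not_dvd_level)
    (hC2 : cesnavicius_not_two_dvd_maninConstant_of_two_dvd_level)
    (h37 : GrossLMS1991.prop37_2_frobeniusCongruence)
    (hPT : ∀ (K : Type) [Field K] [NumberField K],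
      Literature.NumberTheory.GaloisCohomology.poitouTate_selmerStructure_duality_conj K)
    (hF1 : Gross1991_heegnerPoint_sub_ratTorsion_mem_E0_imageFree)
    (hStar : ∀ (W : WeierstrassCurve ℚ) [W.IsElliptic] [W.IsGloballyMinimal] (N : ℕ) [NeZero N]
      (K : Type) [Field K] [NumberField K]
      (Dt : ModularParametrizationData W N) (H : HeegnerDatum N (NumberField.discr K)) (ι : K →+* ℂ)
      (P : (W.baseChange K).toAffine.Point),
      ¬ W.HasCM → Addv W 3 → SubGss W 3 → W.conductorNorm ℤ = N →
      (∀ z ∈ Dt.L.lattice, ∃ w ∈ periodLattice Dt.f, z = Dt.c * w) →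
      ¬ (∃ (q : ℕ) (_ : Fact q.Prime), q ∣ N ∧
          padicValNat 3 W.tamagawaProduct ≤ padicValNat 3 ((W.baseChange ℚ_[q]).localTamagawaNumber ℤ_[q])) →
      IsImaginaryQuadratic K → SatisfiesHeegnerHypothesis N K →
      (WeierstrassCurve.Affine.Point.map ι.toRatAlgHom) P = heegnerPointComplex Dt H →
      ¬ IsOfFinAddOrder P → Odd (NumberField.discr K) →
      ∀ (s' : ℕ), s' ≤ padicValNat 3 W.tamagawaProduct + padicValNat 3 Dt.c.natAbs →
      ∀ (n : ℕ) (d : KolyvaginHeegnerData Dt H.β ι n), Squarefree n →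
      (∀ ℓ ∈ n.primeFactors, Zhang2014.IsKolyvaginPrime N W K 3 ℓ ∧ s' ≤ Zhang2014.kolyvaginIndex W 3 ℓ) →
      Koly.PDiv d 3 s')
    (W : WeierstrassCurve ℚ) [W.IsElliptic] [W.IsGloballyMinimal] [NeZero (W.conductorNorm ℤ)]
    (hCM : ¬ W.HasCM) (hadd : Addv W 3) (hsub : SubGss W 3) (hr : W.analyticRank = 1)
    (Dt : ModularParametrizationData W (W.conductorNorm ℤ))
    (hopt : ∀ z ∈ Dt.L.lattice, ∃ w ∈ periodLattice Dt.f, z = Dt.c * w)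
    (hPL : ∃ (K : Type) (_ : Field K) (_ : NumberField K) (Wd : WeierstrassCurve ℚ) (_ : Wd.IsElliptic) (_ : Wd.IsGloballyMinimal),
      IsImaginaryQuadratic K ∧ Odd (NumberField.discr K) ∧ SatisfiesHeegnerHypothesis (W.conductorNorm ℤ) K ∧
      SatisfiesHeegnerHypothesis 2 K ∧ (W.quadraticTwist (NumberField.discr K : ℚ)).entireLFunction 1 ≠ 0 ∧
      (∃ C : VariableChange ℚ, C • W.quadraticTwist (NumberField.discr K : ℚ) = Wd) ∧ MissingLowerBoundAt Wd 3) :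
    MissingUpperBoundAt W 3 := by
  by_cases hrow : ∃ (q : ℕ) (_ : Fact q.Prime), q ∣ W.conductorNorm ℤ ∧
      padicValNat 3 W.tamagawaProduct ≤ padicValNat 3 ((W.baseChange ℚ_[q]).localTamagawaNumber ℤ_[q])
  · obtain ⟨q, _, hqN, hmono⟩ := hrow
    exact leafRankOneUpper_three_monoCarrierAny_of_anyCarrierReading_of_partnerLowerTwoSplit hGZ hKo hGZK hmod hGZ73 hMN
      (JetchevReadingAnyCarrier.anyCarrierTwoSplitReading_of_namedFacts h37 hPT hF1) W hCM hadd hsub hr q hqN hmono Dt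
      (not_three_dvd_c_of_latticeOptimal_of_subGss hM hAU hC2 hnf W Dt hopt hadd hsub) hPL
  · exact leafRankOneUpper_three_of_sigmaAtDatumTwoSplit_of_partnerLowerTwoSplit hGZ hKo hGZK hmod hGZ73 hMN W hCM hadd hsub
      hr Dt hPL (fun K _ _ H ι P hK hHN _ hLt hP hnt hodd s' hs' n d hn hℓ ↦
        sigmaOptOffMonoRows_of_sigmaStarOptOffMonoRows hStar W (W.conductorNorm ℤ) K Dt H ι P hCM hadd hsub hr rfl hopt hrow hK
          hHN hLt hP hnt hodd s' hs' n d hn hℓ)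

/-! ## §3 The class statement BY NAME: `LeafRankOneUpperAtThree` ⟸ PUB⁺ ∧ three named facts ∧ Σ★‴ ∧ PL₀|₂ — NO S2, NO L₀ -/

/-- **`LeafRankOneUpperAtThree` (26022) BY NAME ⟸ PUB⁺ (27491) ∧ {F1, F2, F3} ∧ Σ★‴ ∧ PL₀|₂** (PL₀|₂ spelled inline: every non-CM leaf curve of
analytic rank one has a Heegner partner of analytic rank zero over a field in which `2` splits, carrying its lower half). p640701 §4 with Σ★″ ↦ Σ★‴.
NO S2 (27492), NO L₀ (26023); PL₀|₂ ⟸ L₀ / ⟸ the leaf (tight) by p640701 §5. CONDITIONAL; U₁ stays OPEN; BSD is not proved.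
[cite: Jetchev2008, Conj. 1.3, Thm. 1.4 (p. 812)] [cite: GrossLMS1991, Prop. 3.7 (2) (p. 240)] [cite: MilneADT2006, Ch. I, Thm. 4.10(b); Thm. I.7.3]
[cite: GrossZagier1986, III (3.1)] [cite: MatarNekovar2019, Thm. 0.7 (p. 456)] [cite: Mazur1978, Cor. 4.1] [cite: Miller2011LMS, Def. 1.1] -/
theorem leafRankOneUpperAtThree_of_pubManin_of_namedFacts_of_sigmaStarMono_of_partnerLowerTwoSplit
    (hpub : LeafRankOnePrintedInputsAtThree)
    (h37 : GrossLMS1991.prop37_2_frobeniusCongruence)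
    (hPT : ∀ (K : Type) [Field K] [NumberField K],
      Literature.NumberTheory.GaloisCohomology.poitouTate_selmerStructure_duality_conj K)
    (hF1 : Gross1991_heegnerPoint_sub_ratTorsion_mem_E0_imageFree)
    (hStar : ∀ (W : WeierstrassCurve ℚ) [W.IsElliptic] [W.IsGloballyMinimal] (N : ℕ) [NeZero N]
      (K : Type) [Field K] [NumberField K]
      (Dt : ModularParametrizationData W N) (H : HeegnerDatum N (NumberField.discr K)) (ι : K →+* ℂ)
      (P : (W.baseChange K).toAffine.Point),
      ¬ W.HasCM → Addv W 3 → SubGss W 3 → W.conductorNorm ℤ = N →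
      (∀ z ∈ Dt.L.lattice, ∃ w ∈ periodLattice Dt.f, z = Dt.c * w) →
      ¬ (∃ (q : ℕ) (_ : Fact q.Prime), q ∣ N ∧
          padicValNat 3 W.tamagawaProduct ≤ padicValNat 3 ((W.baseChange ℚ_[q]).localTamagawaNumber ℤ_[q])) →
      IsImaginaryQuadratic K → SatisfiesHeegnerHypothesis N K →
      (WeierstrassCurve.Affine.Point.map ι.toRatAlgHom) P = heegnerPointComplex Dt H →
      ¬ IsOfFinAddOrder P → Odd (NumberField.discr K) →
      ∀ (s' : ℕ), s' ≤ padicValNat 3 W.tamagawaProduct + padicValNat 3 Dt.c.natAbs →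
      ∀ (n : ℕ) (d : KolyvaginHeegnerData Dt H.β ι n), Squarefree n →
      (∀ ℓ ∈ n.primeFactors, Zhang2014.IsKolyvaginPrime N W K 3 ℓ ∧ s' ≤ Zhang2014.kolyvaginIndex W 3 ℓ) →
      Koly.PDiv d 3 s')
    (hPL : ∀ (W : WeierstrassCurve ℚ) [W.IsElliptic] [W.IsGloballyMinimal], ¬ W.HasCM →
      Literature.NumberTheory.EllipticCurves.Rank1Residual.Addv W 3 →
      Summit.BirchSwinnertonDyer.Rank1Residual.Additive.SubGss W 3 → W.analyticRank = 1 →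
      ∃ (K : Type) (_ : Field K) (_ : NumberField K) (Wd : WeierstrassCurve ℚ) (_ : Wd.IsElliptic) (_ : Wd.IsGloballyMinimal),
        IsImaginaryQuadratic K ∧ Odd (NumberField.discr K) ∧ SatisfiesHeegnerHypothesis (W.conductorNorm ℤ) K ∧
        SatisfiesHeegnerHypothesis 2 K ∧ (W.quadraticTwist (NumberField.discr K : ℚ)).entireLFunction 1 ≠ 0 ∧
        (∃ C : VariableChange ℚ, C • W.quadraticTwist (NumberField.discr K : ℚ) = Wd) ∧ MissingLowerBoundAt Wd 3) :
    LeafRankOneUpperAtThree := by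
  intro W _ _ hCM hadd hsub hr
  obtain ⟨hGZ, hKo, hGZK, hmod, hGZ73, hMN, hnf, -, -, hCassels, hM, hAU, hC2⟩ := hpub
  obtain ⟨W₀, hW₀, hW₀', N, hN0, D₀, hiso, hN₀, -, hopt, hCM₀, hadd₀, hsub₀, hr₀⟩ :=
    exists_optimal_leaf_member hnf W hCM hadd hsub
  haveI := hW₀
  haveI := hW₀'
  haveI := hN0
  have h₀ : MissingUpperBoundAt W₀ 3 := by
    subst hN₀
    exact leafRankOneUpper_three_of_latticeOptimal_of_namedFacts_of_sigmaStarMono_of_partnerLowerTwoSplit hGZ hKo hGZK hmod hGZ73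
      hMN hnf hM hAU hC2 h37 hPT hF1 hStar W₀ hCM₀ hadd₀ hsub₀ (hr₀.trans hr) D₀ hopt (hPL W₀ hCM₀ hadd₀ hsub₀ (hr₀.trans hr))
  exact missingUpperBoundAt_of_isIsogenous_of_analyticRank_le_one hCassels hGZK hmod (le_of_eq hr) hiso h₀

/-! ## §4 Per curve: U₁ on a mono-carrier row of ANY reduction type from PRINT + three named facts + TU₁|₂(W) — the certificate shape -/

/-- **U₁ AT ONE CURVE on a mono-carrier row of ANY reduction type from PRINT + THREE NAMED FACTS + ONE twist-unit certificate (field splitting `2`).**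
For `W/ℚ` globally minimal, non-CM, leaf Gss2 at `3`, `r_an(W) = 1`; a prime `q ∣ N_E` (multiplicative OR additive) with `ord₃ ∏_ℓ c_ℓ(E) ≤ ord₃ c_q(E)`;
a parametrisation datum at level `N_E` with `3 ∤ c`; and TU₁|₂(W): `Typed.MissingUpperBoundAt W 3` follows from the printed named facts
(Gross–Zagier ∀, Kolyvagin ∀, GZK, Version L, GZ I.(7.3), Matar–Nekovář 2019 Thm. 0.7, Cassels) and {F1, F2, F3}. NO S2, NO L₀, NO Σ, NO `q ∥ N`.
= §1 ∘ {`anyCarrierTwoSplitReading_of_namedFacts`, p641092 §1 `partnerLowerTwoSplit_of_twistUnitTwoSplit`}. The certificate shape for the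
single-carrier rank-one Gss2 classes of ANY carrier type (108 = 99 multiplicative + 9 additive). CONDITIONAL on the displayed facts and data;
nothing asserted about any curve; BSD is not proved. [cite: Jetchev2008, Thm. 1.4 and Cor. 1.5 (p. 812)] [cite: GrossLMS1991, Prop. 3.7 (2) (p. 240)]
[cite: MilneADT2006, Ch. I, Thm. 4.10(b); Thm. I.7.3] [cite: GrossZagier1986, III (3.1); Thm. I.(6.3) and (7.3)]
[cite: MatarNekovar2019, Thm. 0.7 (p. 456)] [cite: KrizLi2019, Thm. 1.20] [cite: Miller2011LMS, Def. 1.1] -/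
theorem leafRankOneUpper_three_monoCarrierAny_of_namedFacts_of_twistUnitTwoSplit
    (hGZ : ∀ (N : ℕ) [NeZero N] (W : WeierstrassCurve ℚ) (K : Type) [Field K] [NumberField K],
      gross_zagier N W K)
    (hKo : ∀ (N : ℕ) [NeZero N] (W : WeierstrassCurve ℚ) (K : Type) [Field K] [NumberField K],
      kolyvagin N W K)
    (hGZK : rank_eq_analyticRank_of_analyticRank_le_one) (hmod : hasEntireLFunction_rat)
    (hGZ73 : GrossZagier1986_thm_I_7_3)
    (hMN : MatarNekovar2019.thm07_padicValNat_card_sha_primary_add_le_of_globalDivisibility_of_irreducible)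
    (hCassels : bsdRHS_eq_of_isIsogenous)
    (h37 : GrossLMS1991.prop37_2_frobeniusCongruence)
    (hPT : ∀ (K : Type) [Field K] [NumberField K],
      Literature.NumberTheory.GaloisCohomology.poitouTate_selmerStructure_duality_conj K)
    (hF1 : Gross1991_heegnerPoint_sub_ratTorsion_mem_E0_imageFree)
    (W : WeierstrassCurve ℚ) [W.IsElliptic] [W.IsGloballyMinimal] [NeZero (W.conductorNorm ℤ)]
    (hCM : ¬ W.HasCM) (hadd : Addv W 3) (hsub : SubGss W 3) (hr : W.analyticRank = 1)
    (q : ℕ) [Fact q.Prime] (hqN : q ∣ W.conductorNorm ℤ)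
    (hmono : padicValNat 3 W.tamagawaProduct ≤ padicValNat 3 ((W.baseChange ℚ_[q]).localTamagawaNumber ℤ_[q]))
    (Dt : ModularParametrizationData W (W.conductorNorm ℤ)) (hc : ¬ (3 : ℤ) ∣ Dt.c)
    (hTU : ∃ (K : Type) (_ : Field K) (_ : NumberField K) (W₂ W₂d : WeierstrassCurve ℚ) (_ : W₂.IsElliptic)
      (_ : W₂.IsGloballyMinimal) (_ : W₂d.IsElliptic) (_ : W₂d.IsGloballyMinimal),
      IsImaginaryQuadratic K ∧ Odd (NumberField.discr K) ∧ SatisfiesHeegnerHypothesis (W.conductorNorm ℤ) K ∧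
      SatisfiesHeegnerHypothesis 2 K ∧ (W.quadraticTwist (NumberField.discr K : ℚ)).entireLFunction 1 ≠ 0 ∧
      IsIsogenous W W₂ ∧ (∃ C : VariableChange ℚ, C • W₂.quadraticTwist (NumberField.discr K : ℚ) = W₂d) ∧
      ∃ qd : ℚ, shaAn W₂d = (qd : ℂ) ∧ padicValRat 3 qd ≤ 0) :
    MissingUpperBoundAt W 3 :=
  leafRankOneUpper_three_monoCarrierAny_of_anyCarrierReading_of_partnerLowerTwoSplit hGZ hKo hGZK hmod hGZ73 hMN
    (JetchevReadingAnyCarrier.anyCarrierTwoSplitReading_of_namedFacts h37 hPT hF1) W hCM hadd hsub hr q hqN hmono Dt hc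
    (partnerLowerTwoSplit_of_twistUnitTwoSplit hCassels hGZK hmod W hTU)

/-! ## §5 Class-wide: U₁ BY NAME ⟸ PUB⁺ ∧ three named facts ∧ Σ★‴ ∧ TU₁|₂ -/

/-- **`LeafRankOneUpperAtThree` (26022) BY NAME ⟸ PUB⁺ (27491) ∧ {F1, F2, F3} ∧ Σ★‴ ∧ TU₁|₂** (every non-CM leaf curve of analytic rank one has a
twist-unit field splitting `2`; spelled inline) = §3 with PL₀|₂ supplied by p641092 §1 (Cassels, GZK, Version L from PUB⁺). TU₁|₂ has surplus over
the leaf — the tight form is PL₀|₂. CONDITIONAL; U₁ stays OPEN; BSD is not proved. [cite: Jetchev2008, Conj. 1.3, Thm. 1.4 (p. 812)]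
[cite: GrossLMS1991, Prop. 3.7 (2)] [cite: MilneADT2006, Thm. I.7.3] [cite: KrizLi2019, Thm. 1.20] [cite: Miller2011LMS, Def. 1.1] -/
theorem leafRankOneUpperAtThree_of_pubManin_of_namedFacts_of_sigmaStarMono_of_twistUnitTwoSplit
    (hpub : LeafRankOnePrintedInputsAtThree)
    (h37 : GrossLMS1991.prop37_2_frobeniusCongruence)
    (hPT : ∀ (K : Type) [Field K] [NumberField K],
      Literature.NumberTheory.GaloisCohomology.poitouTate_selmerStructure_duality_conj K)
    (hF1 : Gross1991_heegnerPoint_sub_ratTorsion_mem_E0_imageFree)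
    (hStar : ∀ (W : WeierstrassCurve ℚ) [W.IsElliptic] [W.IsGloballyMinimal] (N : ℕ) [NeZero N]
      (K : Type) [Field K] [NumberField K]
      (Dt : ModularParametrizationData W N) (H : HeegnerDatum N (NumberField.discr K)) (ι : K →+* ℂ)
      (P : (W.baseChange K).toAffine.Point),
      ¬ W.HasCM → Addv W 3 → SubGss W 3 → W.conductorNorm ℤ = N →
      (∀ z ∈ Dt.L.lattice, ∃ w ∈ periodLattice Dt.f, z = Dt.c * w) →
      ¬ (∃ (q : ℕ) (_ : Fact q.Prime), q ∣ N ∧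
          padicValNat 3 W.tamagawaProduct ≤ padicValNat 3 ((W.baseChange ℚ_[q]).localTamagawaNumber ℤ_[q])) →
      IsImaginaryQuadratic K → SatisfiesHeegnerHypothesis N K →
      (WeierstrassCurve.Affine.Point.map ι.toRatAlgHom) P = heegnerPointComplex Dt H →
      ¬ IsOfFinAddOrder P → Odd (NumberField.discr K) →
      ∀ (s' : ℕ), s' ≤ padicValNat 3 W.tamagawaProduct + padicValNat 3 Dt.c.natAbs →
      ∀ (n : ℕ) (d : KolyvaginHeegnerData Dt H.β ι n), Squarefree n →
      (∀ ℓ ∈ n.primeFactors, Zhang2014.IsKolyvaginPrime N W K 3 ℓ ∧ s' ≤ Zhang2014.kolyvaginIndex W 3 ℓ) →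
      Koly.PDiv d 3 s')
    (hTU : ∀ (W : WeierstrassCurve ℚ) [W.IsElliptic] [W.IsGloballyMinimal], ¬ W.HasCM →
      Literature.NumberTheory.EllipticCurves.Rank1Residual.Addv W 3 →
      Summit.BirchSwinnertonDyer.Rank1Residual.Additive.SubGss W 3 → W.analyticRank = 1 →
      ∃ (K : Type) (_ : Field K) (_ : NumberField K) (W₂ W₂d : WeierstrassCurve ℚ) (_ : W₂.IsElliptic)
        (_ : W₂.IsGloballyMinimal) (_ : W₂d.IsElliptic) (_ : W₂d.IsGloballyMinimal),
        IsImaginaryQuadratic K ∧ Odd (NumberField.discr K) ∧ SatisfiesHeegnerHypothesis (W.conductorNorm ℤ) K ∧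
        SatisfiesHeegnerHypothesis 2 K ∧ (W.quadraticTwist (NumberField.discr K : ℚ)).entireLFunction 1 ≠ 0 ∧
        IsIsogenous W W₂ ∧ (∃ C : VariableChange ℚ, C • W₂.quadraticTwist (NumberField.discr K : ℚ) = W₂d) ∧
        ∃ qd : ℚ, shaAn W₂d = (qd : ℂ) ∧ padicValRat 3 qd ≤ 0) :
    LeafRankOneUpperAtThree := by
  obtain ⟨-, -, hGZK, hmod, -, -, -, -, -, hCassels, -, -, -⟩ := id hpub
  exact leafRankOneUpperAtThree_of_pubManin_of_namedFacts_of_sigmaStarMono_of_partnerLowerTwoSplit hpub h37 hPT hF1 hStar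
    (fun W _ _ hCM hadd hsub hr ↦ partnerLowerTwoSplit_of_twistUnitTwoSplit hCassels hGZK hmod W (hTU W hCM hadd hsub hr))

end Summit.BirchSwinnertonDyer.BirchSwinnertonDyer.Theorems.RamifiedPairUpperBound

end
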